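import Literature.NumberTheory.GaloisRepresentations.IdeleClassBarSLayerKernel
import Literature.NumberTheory.GaloisRepresentations.GlobalPFinitenessProofs
import Mathlib.RepresentationTheory.Homological.GroupCohomology.LowDegree
import HarnessLib

/-!
# `C̄_S^{Gal(K_S/E)} = C_S(E)`: every element of the `S`-idèle class module fixed by `Gal(K_S/E)` comes from `C_E`
# (NSW (8.3.7)/(8.3.8) `C_S(K) = C_S^{G_S(K)}`; Harari Prop. 15.40 (b), proof of Thm. 17.2; Milne ADT I §4)

Topic `NumberTheory/GaloisRepresentations`; namespace `Literature.NumberTheory.GaloisRepresentations.IdeleClassBar`.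
Sequel to `IdeleClassBarSLayerKernel.lean` (the kernel of `C_E → C̄_S` is `U_{E,S}`), `IdeleClassBarS.lean`
(`classBarSRep K S = C̄_S`, `ofLayerS`), door-c5's `IdeleClassGroupLimitAction.lean` (`H⁰(Gal(K̄/E), C̄) = C_E`,
`exists_ofLayer_eq_of_forall_mem_fixingSubgroup`), `IdeleUnitsOffS.lean` (`isZero_groupCohomology_res_unitsOffRep`:
`H¹(U, U_{M,S}) = 0` for every `U ≤ Gal(M/K)` when `M/K` is unramified outside `S`) and `GlobalPFinitenessProofs.lean`
(`isUnramifiedIn_of_ramificationSubgroup_le_fixingSubgroup`: `M ⊆ K_S ⟹ M/K` unramified outside `S`).  THEOREMS ONLY;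
no definition, no named fact, no instance, no `sorry`.  Cell `bsd-eis`, background lane «PT-Ш-S-TC», written
`--supports` crux `GoodLatticeBDPValue` (stmt-BirchSwinnertonDyer-19032).  HONEST FRAMING: the layer identification of a
classical object; no duality theorem and no case of BSD is proved here.

Mathematics (NSW (8.3.7): "`C_S(K) = C_S^{G_S(K)}` for `K ⊆ k_S`"; Harari, proof of Thm. 17.2: the cohomology of
`0 → U_S → C(k_S) → C_S → 0` with `U_S` cohomologically trivial, Prop. 15.40 (b)).  Let `E ⊆ K_S` be a finite Galois
layer and `z ∈ C̄_S = C_{K_S} ⧸ Ū_S` be fixed by `Gal(K_S/E)` (i.e. by every `[σ]`, `σ ∈ Gal(K̄/E)`).  Write `z` as the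
image of `y ∈ C_M` for a layer `E ⊆ M ⊆ K_S`.  For `σ ∈ Gal(K̄/E)`, `σy − y` dies in `C̄_S`, so (kernel file)
`σy − y = [u_σ]` for a unique `u_σ ∈ U_{M,S}`; on the image `H ≤ Gal(M/K)` of `Gal(K̄/E)` this is a `1`-COCYCLE
`H → U_{M,S}` (uniqueness and the equivariance of `U_{M,S} → C_M`).  As `M ⊆ K_S`, `M/K` is unramified outside `S`, so
`H¹(H, U_{M,S}) = 0` (Harari Prop. 15.40 (b)) and `u_σ = σa − a` for some `a ∈ U_{M,S}`; then `w = y − [a] ∈ C_M` is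
fixed by `Gal(K̄/E)`, hence (`H⁰(Gal(K̄/E), C̄) = C_E`) `w` comes from `x ∈ C_E`, and `x ↦ z`.  With the kernel file:
**`C_S(E) = C_E ⧸ U_{E,S} ⥲ C̄_S^{Gal(K_S/E)}`** (injective with image the invariants), the layer identification that
door-c4's layer-colimit computation of `Hⁿ(U, C̄_S)` for open `U ≤ G_S` consumes.

## What is formalised (`K : Type` a number field, `S : Finset (HeightOneSpectrum (𝓞 K))`, layers `E ≤ M ⊆ K_S`)

* §1 `isUnramifiedIn_of_insideKS` (`M ⊆ K_S ⟹ M/K` unramified outside `S`), `layerAct_sub_mem_range_of_forall`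
  (`σy − y ∈ im U_{M,S}` for `σ ∈ Gal(K̄/E)` when the image of `y` is `Gal(K_S/E)`-fixed),
  **`exists_transHom_sub_mem_range_of_forall`** (the cocycle argument: such `y` is `x_M + [a]`, `x ∈ C_E`, `a ∈ U_{M,S}`).
* §2 **`exists_ofLayerS_eq_of_forall_mem`** (`C̄_S^{Gal(K_S/E)} ⊆ im(C_E → C̄_S)`), **`mem_range_ofLayerS_iff`**
  (`im(C_E → C̄_S) = C̄_S^{Gal(K_S/E)}`), `exists_unique_ofLayerS_eq_mod` (with the kernel: unique up to `U_{E,S}`).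

## References
* J. Neukirch, A. Schmidt, K. Wingberg, *Cohomology of Number Fields*, 2nd ed. (2008), VIII §3 (8.3.7)–(8.3.8).
  [NeukirchSchmidtWingberg2008]
* D. Harari, *Galois Cohomology and Class Field Theory*, Universitext (2020), Prop. 15.40 (b), §17.1 Thm. 17.2 (proof).
  [Harari2020]
* J. S. Milne, *Arithmetic Duality Theorems*, 2nd ed. (2006), I §4 (p. 55). [MilneADT2006]
-/

noncomputable section

open NumberField IsDedekindDomain CategoryTheory groupCohomology
open Field (absoluteGaloisGroup)
open Literature.NumberTheory.Automorphic Literature.NumberTheory.Automorphic.IdeleClassGroup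
open Literature.NumberTheory.NumberFields
open Literature.Algebra.Homology
open Literature.NumberTheory.GaloisRepresentations.LocalWeilDatum (galFixing)
open scoped Classical

namespace Literature.NumberTheory.GaloisRepresentations

namespace IdeleClassBar

variable {K : Type} [Field K] [NumberField K] (S : Finset (HeightOneSpectrum (𝓞 K)))

/-! ## §1. The cocycle `σ ↦ u_σ` and its triviality -/

/-- **`M ⊆ K_S ⟹ M/K` is unramified outside `S`** (a layer form of the tree's
`isUnramifiedIn_of_ramificationSubgroup_le_fixingSubgroup`, `GlobalPFinitenessProofs.lean`).
[cite: NeukirchSchmidtWingberg2008, VIII §3] -/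
theorem isUnramifiedIn_of_insideKS {M : GalLayer K}
    (hM : ramificationSubgroup K (↑S : Set (HeightOneSpectrum (𝓞 K))) ≤ galFixing K M.1)
    {v : HeightOneSpectrum (𝓞 K)} (hv : v ∉ S) :
    haveI := M.numberField; Algebra.IsUnramifiedIn (𝓞 M.1) v.asIdeal := by
  haveI := M.numberField
  haveI := M.isGalois
  exact isUnramifiedIn_of_ramificationSubgroup_le_fixingSubgroup M.1 hM (fun h => hv (Finset.mem_coe.1 h))

/-- If the image of `y ∈ C_M` in `C̄_S` is fixed by `Gal(K_S/E)` (`E ≤ M ⊆ K_S`), then **`σy − y ∈ im(U_{M,S} → C_M)` for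
every `σ ∈ Gal(K̄/E)`** (the kernel of `C_M → C̄_S` is `U_{M,S}`, `IdeleClassBarSLayerKernel`).
[cite: Harari2020, §17.1 Thm. 17.2 (proof)][cite: NeukirchSchmidtWingberg2008, VIII §3 (8.3.8)] -/
theorem layerAct_sub_mem_range_of_forall {E M : GalLayer K}
    (hM : ramificationSubgroup K (↑S : Set (HeightOneSpectrum (𝓞 K))) ≤ galFixing K M.1) (y : layerClass K M)
    (hy : ∀ σ ∈ galFixing K E.1, ofLayerS S hM (layerAct K M σ y) = ofLayerS S hM y)
    {σ : absoluteGaloisGroup K} (hσ : σ ∈ galFixing K E.1) :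
    haveI := M.numberField;
      layerAct K M σ y - y ∈ (IdeleCohomology.unitsOffToClass (F := K) (E := M.1) S).hom.range :=
  (ofLayerS_eq_ofLayerS_iff S hM _ _).1 (hy σ hσ)

/-- **The cocycle argument.**  Let `E ≤ M ⊆ K_S` be layers and `y ∈ C_M` with `σy − y ∈ im U_{M,S}` for all
`σ ∈ Gal(K̄/E)`.  Then `y = x_M + [a]` for some `x ∈ C_E` and `a ∈ U_{M,S}`: on the image `H ≤ Gal(M/K)` of `Gal(K̄/E)`,
`g ↦ u_g` (`[u_g] = gy − y`) is a `1`-cocycle with values in `U_{M,S}`; `M/K` is unramified outside `S`, so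
`H¹(H, U_{M,S}) = 0` (Harari Prop. 15.40 (b), `isZero_groupCohomology_res_unitsOffRep`) and `u_g = ga − a`; then
`y − [a]` is `Gal(K̄/E)`-fixed, hence comes from `C_E` (door-c5's Galois descent `exists_ofLayer_eq_of_forall_mem_fixingSubgroup`,
`C_E ↪ C̄`). [cite: Harari2020, Prop. 15.40 (b), §17.1 Thm. 17.2 (proof)][cite: NeukirchSchmidtWingberg2008, VIII §3 (8.3.7)] -/
theorem exists_transHom_sub_mem_range_of_forall {E M : GalLayer K} (h : E ≤ M)
    (hM : ramificationSubgroup K (↑S : Set (HeightOneSpectrum (𝓞 K))) ≤ galFixing K M.1) (y : layerClass K M)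
    (hy : ∀ σ ∈ galFixing K E.1, haveI := M.numberField;
      layerAct K M σ y - y ∈ (IdeleCohomology.unitsOffToClass (F := K) (E := M.1) S).hom.range) :
    ∃ (x : layerClass K E) (a : haveI := M.numberField; (IdeleCohomology.unitsOffRep K M.1 S).V),
      haveI := M.numberField; transHom E M h x + (IdeleCohomology.unitsOffToClass (F := K) (E := M.1) S).hom a = y := by
  haveI := M.numberField
  haveI := M.isGalois
  -- `M/K` is unramified outside `S`, so `H¹(H, U_{M,S}) = 0` for the image `H ≤ Gal(M/K)` of `Gal(K̄/E)`
  have hS : ∀ v : HeightOneSpectrum (𝓞 K), v ∉ S → Algebra.IsUnramifiedIn (𝓞 M.1) v.asIdeal :=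
    fun v hv => isUnramifiedIn_of_insideKS S hM hv
  haveI : Subsingleton (groupCohomology.H1
      (Rep.res ((galFixing K E.1).map (GalLayer.restrictHom M)).subtype (IdeleCohomology.unitsOffRep K M.1 S))) :=
    ModuleCat.subsingleton_of_isZero
      (IdeleCohomology.isZero_groupCohomology_res_unitsOffRep S hS ((galFixing K E.1).map (GalLayer.restrictHom M)) 1)
  -- the values `u_g ∈ U_{M,S}`, `[u_g] = g y - y`, for `g ∈ H`
  have hval : ∀ g : (galFixing K E.1).map (GalLayer.restrictHom M), ∃ u : (IdeleCohomology.unitsOffRep K M.1 S).V,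
      (IdeleCohomology.unitsOffToClass (F := K) (E := M.1) S).hom u =
        (IdeleClassGroup.galoisRep K M.1).ρ (g : M.1 ≃ₐ[K] M.1) y - y := by
    rintro ⟨g, hg⟩
    obtain ⟨σ, hσ, rfl⟩ := Subgroup.mem_map.1 hg
    exact hy σ hσ
  choose f hf using hval
  -- `f` is a `1`-cocycle: `[f (g g')] = gg' y - y = g (g' y - y) + (g y - y) = [g • f g' + f g]`
  have hcoc : f ∈ cocycles₁
      (Rep.res ((galFixing K E.1).map (GalLayer.restrictHom M)).subtype (IdeleCohomology.unitsOffRep K M.1 S)) := by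
    refine (mem_cocycles₁_iff
      (A := Rep.res ((galFixing K E.1).map (GalLayer.restrictHom M)).subtype (IdeleCohomology.unitsOffRep K M.1 S))
      f).2 fun g g' => ?_
    apply IdeleCohomology.unitsOffToClass_injective S
    -- in `C_M`: `[f (g g')] = gg' y - y` and `[g • f g' + f g] = g (g' y - y) + (g y - y)`
    -- (`simp only`, not `rw`: reducible matching keeps the unifier away from the idèle action)
    simp only [map_add, MonoidHom.coe_comp, Function.comp_apply, Subgroup.coe_subtype, Rep.hom_comm_apply, hf,
      Subgroup.coe_mul, map_mul, Module.End.mul_apply, map_sub]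
    abel
  -- `H¹ = 0`: `f` is a coboundary, `f g = g a - a` for some `a ∈ U_{M,S}`
  have h0 : H1π (Rep.res ((galFixing K E.1).map (GalLayer.restrictHom M)).subtype (IdeleCohomology.unitsOffRep K M.1 S))
      ⟨f, hcoc⟩ = 0 := Subsingleton.elim _ _
  obtain ⟨a, ha⟩ := (H1π_eq_zero_iff
    (A := Rep.res ((galFixing K E.1).map (GalLayer.restrictHom M)).subtype (IdeleCohomology.unitsOffRep K M.1 S))
    ⟨f, hcoc⟩).1 h0
  have hfa : ∀ g : (galFixing K E.1).map (GalLayer.restrictHom M),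
      f g = (IdeleCohomology.unitsOffRep K M.1 S).ρ (g : M.1 ≃ₐ[K] M.1) a - a := fun g => by
    have h1 := congrFun ha g
    simp only [d₀₁_hom_apply] at h1
    exact h1.symm
  -- `w := y - [a]` is fixed by `Gal(K̄/E)`
  have hwfix : ∀ σ ∈ E.1.fixingSubgroup,
      barRep K σ (ofLayer K M (y - (IdeleCohomology.unitsOffToClass (F := K) (E := M.1) S).hom a)) =
        ofLayer K M (y - (IdeleCohomology.unitsOffToClass (F := K) (E := M.1) S).hom a) := by
    intro σ hσ
    have hg : GalLayer.restrictHom M σ ∈ (galFixing K E.1).map (GalLayer.restrictHom M) :=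
      Subgroup.mem_map.2 ⟨σ, hσ, rfl⟩
    rw [barRep_ofLayer]
    refine congrArg (ofLayer K M) ?_
    -- `σ w = σ y - [σ a] = σ y - [f g + a] = σ y - (σ y - y) - [a] = w`
    have h1 : layerAct K M σ y = (IdeleClassGroup.galoisRep K M.1).ρ (GalLayer.restrictHom M σ) y := rfl
    have h2 : layerAct K M σ ((IdeleCohomology.unitsOffToClass (F := K) (E := M.1) S).hom a) =
        (IdeleCohomology.unitsOffToClass (F := K) (E := M.1) S).hom
          ((IdeleCohomology.unitsOffRep K M.1 S).ρ (GalLayer.restrictHom M σ) a) :=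
      (Rep.hom_comm_apply (IdeleCohomology.unitsOffToClass (F := K) (E := M.1) S) (GalLayer.restrictHom M σ) a).symm
    have h3 : (IdeleCohomology.unitsOffRep K M.1 S).ρ (GalLayer.restrictHom M σ) a =
        f ⟨GalLayer.restrictHom M σ, hg⟩ + a := by
      rw [hfa ⟨GalLayer.restrictHom M σ, hg⟩, sub_add_cancel]
    have h4 := hf ⟨GalLayer.restrictHom M σ, hg⟩
    simp only [map_sub, map_add, h1, h2, h3, h4]
    abel
  -- Galois descent: `w` comes from `C_E`
  obtain ⟨x, hx⟩ := exists_ofLayer_eq_of_forall_mem_fixingSubgroup E _ hwfix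
  refine ⟨x, a, ?_⟩
  have hx' : transHom E M h x = y - (IdeleCohomology.unitsOffToClass (F := K) (E := M.1) S).hom a :=
    ofLayer_injective M (by rw [ofLayer_transHom, hx])
  rw [hx', sub_add_cancel]

/-! ## §2. `C̄_S^{Gal(K_S/E)} = im(C_E → C̄_S)` -/

/-- **`C̄_S^{Gal(K_S/E)} ⊆ im(C_E → C̄_S)`**: an element of `C̄_S` fixed by every `[σ]`, `σ ∈ Gal(K̄/E)`, is `ofLayerS x`
for some `x ∈ C_E` (`E ⊆ K_S` a finite Galois layer).  NSW (8.3.7): `C_S(K) = C_S^{G_S(K)}`.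
[cite: NeukirchSchmidtWingberg2008, VIII §3 (8.3.7)][cite: Harari2020, Prop. 15.40 (b), §17.1 Thm. 17.2 (proof)] -/
theorem exists_ofLayerS_eq_of_forall_mem {E : GalLayer K}
    (hE : ramificationSubgroup K (↑S : Set (HeightOneSpectrum (𝓞 K))) ≤ galFixing K E.1) (z : (classBarSRep K S).V)
    (hz : ∀ σ ∈ galFixing K E.1, (classBarSRep K S).ρ (QuotientGroup.mk σ) z = z) :
    ∃ x : layerClass K E, ofLayerS S hE x = z := by
  obtain ⟨E', hE', y', rfl⟩ := exists_ofLayerS S z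
  obtain ⟨M, h, h', hM⟩ := exists_ge_ge_insideKS S hE hE'
  haveI := M.numberField
  -- move `y'` to the common layer `M ⊇ E, E'`
  set y : layerClass K M := transHom E' M h' y' with hy_def
  have hyz : ofLayerS S hM y = ofLayerS S hE' y' := ofLayerS_transHom S h' hE' hM y'
  have hy : ∀ σ ∈ galFixing K E.1,
      layerAct K M σ y - y ∈ (IdeleCohomology.unitsOffToClass (F := K) (E := M.1) S).hom.range := by
    refine fun σ hσ => layerAct_sub_mem_range_of_forall S hM y (fun τ hτ => ?_) hσ
    rw [← classBarSRep_ρ_mk_ofLayerS, hyz]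
    exact hz τ hτ
  obtain ⟨x, a, hxa⟩ := exists_transHom_sub_mem_range_of_forall S h hM y hy
  refine ⟨x, ?_⟩
  rw [← hyz, ← hxa, map_add, ofLayerS_unitsOffToClass, add_zero, ofLayerS_transHom]

/-- **`im(C_E → C̄_S) = C̄_S^{Gal(K_S/E)}`**: `z` is in the image of `C_E` iff it is fixed by every `[σ]`, `σ ∈ Gal(K̄/E)`
(with `classBarSRep_ρ_mk_ofLayerS_of_mem`).  Together with `ofLayerS_eq_zero_iff` (kernel `= U_{E,S}`):
`C_S(E) = C_E ⧸ U_{E,S} ⥲ C̄_S^{Gal(K_S/E)}`. [cite: NeukirchSchmidtWingberg2008, VIII §3 (8.3.7)–(8.3.8)]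
[cite: Harari2020, §17.1 Thm. 17.2 (proof)] -/
theorem mem_range_ofLayerS_iff {E : GalLayer K}
    (hE : ramificationSubgroup K (↑S : Set (HeightOneSpectrum (𝓞 K))) ≤ galFixing K E.1) (z : (classBarSRep K S).V) :
    z ∈ Set.range (ofLayerS S hE) ↔ ∀ σ ∈ galFixing K E.1, (classBarSRep K S).ρ (QuotientGroup.mk σ) z = z := by
  constructor
  · rintro ⟨x, rfl⟩ σ hσ
    exact classBarSRep_ρ_mk_ofLayerS_of_mem S hE hσ x
  · intro hz
    obtain ⟨x, hx⟩ := exists_ofLayerS_eq_of_forall_mem S hE z hz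
    exact ⟨x, hx⟩

/-- **`C_S(E) ⥲ C̄_S^{Gal(K_S/E)}`, existence-and-uniqueness form**: an element of `C̄_S` fixed by `Gal(K_S/E)` is
`ofLayerS x` for an `x ∈ C_E` unique modulo `im(U_{E,S} → C_E)`.
[cite: NeukirchSchmidtWingberg2008, VIII §3 (8.3.7)–(8.3.8)][cite: Harari2020, Def. 15.38, §17.1 Thm. 17.2 (proof)] -/
theorem exists_ofLayerS_eq_unique_mod {E : GalLayer K}
    (hE : ramificationSubgroup K (↑S : Set (HeightOneSpectrum (𝓞 K))) ≤ galFixing K E.1) (z : (classBarSRep K S).V)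
    (hz : ∀ σ ∈ galFixing K E.1, (classBarSRep K S).ρ (QuotientGroup.mk σ) z = z) :
    ∃ x : layerClass K E, ofLayerS S hE x = z ∧
      ∀ x' : layerClass K E, ofLayerS S hE x' = z →
        haveI := E.numberField; x' - x ∈ (IdeleCohomology.unitsOffToClass (F := K) (E := E.1) S).hom.range := by
  obtain ⟨x, hx⟩ := exists_ofLayerS_eq_of_forall_mem S hE z hz
  exact ⟨x, hx, fun x' hx' => (ofLayerS_eq_ofLayerS_iff S hE x' x).1 (hx'.trans hx.symm)⟩

end IdeleClassBar

end Literature.NumberTheory.GaloisRepresentations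

end
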